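import Literature.NumberTheory.EllipticCurves.TwoAdicImageSurjectivityProofs
import Literature.NumberTheory.GaloisRepresentations.SerreGL2LiftingLevelPSquared
import HarnessLib

/-!
# `ρ̄_{E,p²}` onto ⟹ `ρ̄_{E,p^n}` onto for every `n` (odd `p`); in particular the `3`-adic image is onto
# iff it is onto modulo `9`

Topic `NumberTheory/EllipticCurves`; namespace `Literature.NumberTheory.EllipticCurves`. Theorems only: **no
definition and no named fact is introduced.** This is the elliptic-curve companion announced in the module
docstring of `Literature.NumberTheory.GaloisRepresentations.SerreGL2LiftingLevelPSquared` (the group theory: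
for an odd prime `p`, a subgroup of `GL₂(ℤ/p^N ℤ)` mapping onto `GL₂(ℤ/p² ℤ)` is everything,
`Serre1968.generalLinearGroup_eq_top_of_map_sq_surjective`) and the odd-`p` sibling of
`TwoAdicImageSurjectivityProofs` (`hasSurjectiveModNGaloisRep_two_pow_of_eight_holds`: level `8` at `p = 2`) and
of `BSDSelmerPConverseSerreProofs` (`serre_hasSurjectiveModNGaloisRep_pow_holds`: level `p` at `p ≥ 5`).
J.-P. Serre, *Abelian `ℓ`-adic representations and elliptic curves* (1968), Ch. IV §3.4, Lemma 3 and the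
Exercises to §3.4; T. Dokchitser, V. Dokchitser, Math. Z. 272 (2012), Introduction («`ρ̄_{l^n}` surjective ⇏
`ρ̄_{l^{n+1}}` surjective for `l^n = 2, 3, 4`» — so at `p = 3` level `9` is the right hypothesis; N. Elkies,
arXiv:math/0612734, classifies the curves onto mod `3` but not mod `9`).

* `hasSurjectiveModNGaloisRep_pow_of_sq` — for `E` elliptic over any field `F` with `(p : F) ≠ 0`, `p` an odd
  prime: `ρ̄_{E,p²} : Γ_F → Aut E[p²]` onto ⟹ `ρ̄_{E,p^n}` onto for EVERY `n` (downwards for `n ≤ 1`,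
  `hasSurjectiveModNGaloisRep_pow_of_pow_add`; upwards by the group lemma on the framed representation,
  `exists_map_eq_of_hasSurjectiveModNGaloisRep_pow` + `hasSurjectiveModNGaloisRep_of_rep_surjective`).
* `hasSurjectiveModNGaloisRep_three_pow_of_nine` — `p = 3`: `ρ̄_{E,9}` onto ⟹ `ρ̄_{E,3^n}` onto for all `n`;
  over `ℚ` this is the census bit «`3`-adic tower onto» of the BSD cells (e.g. the binder
  `AdditiveThree.TowerSurjThree` of the wild-at-`3` routes), now checkable from the mod-`9` image alone.

No determinant input is needed (the hypothesis is about `GL₂`), so the statements hold over every field of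
characteristic `≠ p`, not only over `ℚ`.

## References

* [SerreAbelianLadic1968] J.-P. Serre, *op. cit.*, Ch. IV §3.4, Lemma 3 and Exercises.
* [DokchitserDokchitserMathZ2012] T. and V. Dokchitser, Math. Z. 272 (2012), Introduction (p. 961).
* [Elkies2006ThreeAdic] N. D. Elkies, arXiv:math/0612734, §0.
-/

noncomputable section

open scoped Classical MatrixGroups

open WeierstrassCurve Matrix

universe u

namespace Literature.NumberTheory.EllipticCurves

/-- **`ρ̄_{E,p²}` onto ⟹ `ρ̄_{E,p^n}` onto for every `n`, `p` an odd prime** (Serre 1968 IV §3.4, Lemma 3 /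
Exercises, started at level `p²`; Dokchitser–Dokchitser 2012, Introduction). For `E` elliptic over a field `F`
with `(p : F) ≠ 0`. Proof: `n = 0`: `E[1] = 0`; `n = 1`: downwards from `p² = p^{1+1}`
(`hasSurjectiveModNGaloisRep_pow_of_pow_add`); `n = 2 + j`: frame `E[p^n] ≅ (ℤ/p^n)²`
(`nonempty_addEquiv_geomTorsion`) with representation `ρ` (`exists_rep_of_addEquiv`), whose image maps onto
`GL₂(ℤ/p²)` (`exists_map_eq_of_hasSurjectiveModNGaloisRep_pow`), hence is everything
(`Serre1968.generalLinearGroup_eq_top_of_map_sq_surjective`), hence `ρ̄_{E,p^n}` is onto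
(`hasSurjectiveModNGaloisRep_of_rep_surjective`). [cite: SerreAbelianLadic1968, Ch. IV §3.4, Lemma 3 and Exercises]
[cite: DokchitserDokchitserMathZ2012, Introduction (p. 961)] -/
theorem hasSurjectiveModNGaloisRep_pow_of_sq {F : Type u} [Field F] (W : WeierstrassCurve F) [W.IsElliptic]
    (p : ℕ) [Fact p.Prime] (hp3 : 3 ≤ p) (hpF : (p : F) ≠ 0)
    (hsurj : W.HasSurjectiveModNGaloisRep ((p ^ 2 : ℕ) : ℤ)) (n : ℕ) :
    W.HasSurjectiveModNGaloisRep ((p ^ n : ℕ) : ℤ) := by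
  have hp : p.Prime := Fact.out
  rcases Nat.lt_or_ge n 2 with hn | hn
  · interval_cases n
    · -- `n = 0`: `E[1] = 0`
      haveI : Subsingleton (geomTorsion W ((p ^ 0 : ℕ) : ℤ)) := ⟨fun a b ↦ by
        have ha := AddSubgroup.torsionBy.nsmul_iff.mp a.2
        have hb := AddSubgroup.torsionBy.nsmul_iff.mp b.2
        simp only [pow_zero, one_smul] at ha hb
        exact Subtype.ext (ha.trans hb.symm)⟩
      intro y
      exact ⟨1, Multiplicative.toAdd.injective (AddEquiv.ext fun a ↦ Subsingleton.elim _ _)⟩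
    · -- `n = 1`: downward from `p^(1+1)`
      exact hasSurjectiveModNGaloisRep_pow_of_pow_add W p 1 1 one_pos hpF hsurj
  · -- `n ≥ 2`: upward by the level-`p²` lifting lemma
    obtain ⟨j, rfl⟩ : ∃ j, n = 2 + j := ⟨n - 2, by omega⟩
    obtain ⟨e⟩ := nonempty_addEquiv_geomTorsion W p (2 + j) (by omega) hpF
    obtain ⟨ρ, hρ⟩ := exists_rep_of_addEquiv W e
    have htop : ρ.range = ⊤ := by
      refine GaloisRepresentations.Serre1968.generalLinearGroup_eq_top_of_map_sq_surjective hp3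
        (Nat.le_add_right 2 j) ρ.range (fun t ↦ ?_)
      obtain ⟨σ, hσ⟩ := exists_map_eq_of_hasSurjectiveModNGaloisRep_pow W p 2 j hpF e ρ hρ hsurj t
      exact ⟨ρ σ, ⟨σ, rfl⟩, hσ⟩
    have hρsurj : Function.Surjective ρ := fun B ↦ by
      obtain ⟨σ, hσ⟩ : B ∈ ρ.range := htop ▸ Subgroup.mem_top B
      exact ⟨σ, hσ⟩
    exact hasSurjectiveModNGaloisRep_of_rep_surjective W e ρ hρ hρsurj

/-- **The `3`-adic tower from level `9`: `ρ̄_{E,9}` onto ⟹ `ρ̄_{E,3^n}` onto for every `n`** (any field of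
characteristic `≠ 3`). `ρ̄_{E,3}` onto alone does NOT suffice (Elkies, arXiv:math/0612734); over `ℚ` this turns
the census bit «onto mod `9`» into `3`-adic tower surjectivity. [cite: SerreAbelianLadic1968, Ch. IV §3.4, Lemma 3 and Exercises]
[cite: Elkies2006ThreeAdic, §0] -/
theorem hasSurjectiveModNGaloisRep_three_pow_of_nine {F : Type u} [Field F] (W : WeierstrassCurve F)
    [W.IsElliptic] (h3F : (3 : F) ≠ 0) (hsurj : W.HasSurjectiveModNGaloisRep 9) (n : ℕ) :
    W.HasSurjectiveModNGaloisRep ((3 ^ n : ℕ) : ℤ) := by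
  haveI : Fact (Nat.Prime 3) := ⟨Nat.prime_three⟩
  have h9 : W.HasSurjectiveModNGaloisRep ((3 ^ 2 : ℕ) : ℤ) := by norm_num; exact hsurj
  exact hasSurjectiveModNGaloisRep_pow_of_sq W 3 le_rfl (by exact_mod_cast h3F) h9 n

end Literature.NumberTheory.EllipticCurves

end
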